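import Summits.AtomisticToContinuum.FouriersLaw.Theorems.VanishingNoiseTransferVanishingNoiseBoundJumpPerturbationMass
import Summits.AtomisticToContinuum.FouriersLaw.Theorems.VanishingNoiseTransferVanishingNoiseBoundJumpPerturbationCK
import Literature.MathematicalPhysics.KineticTheory.LangevinChainResolvent
import Mathlib.Algebra.Order.Antidiag.Prod
import Mathlib.Algebra.BigOperators.NatAntidiagonal

/-!
# Jump perturbation of a measurable Markov semigroup, IV: the perturbed semigroup and its Laplace transform
(brick for crux stmt-AtomisticToContinuum-11976 `VanishingNoiseTransfer.VanishingNoiseBound`, line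
`fekete-usc-one-length`, stub S3 `stub_noisyPositiveConductance`; worker file, wave 2)

Step IV of the construction of the flip semigroup of `L + εS` as a jump perturbation of the flip-free
transition semigroup (overview in `…JumpPerturbationCore.lean`; steps II–III: the Poisson weights and
Chapman–Kolmogorov by the number of jumps). For an abstract Dyson–Phillips family `U n` over `(K, Q, r)`
and the perturbed kernels `V_t(x) = ∑_n U_n(t, x)` (a family `V : ℝ≥0 → Kernel X X` given together with
this defining identity, hypothesis `hV`; no definition is introduced):

* `lintegral_V`, `isMarkovKernel_V` (`V_t` is Markov: the Poisson weights sum to one), `smul_kernel_le_V`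
  (DOMINATION `V_t(x,·) ≥ e^{-rt} P_t(x,·)`, the no-jump event), `V_add` — **Chapman–Kolmogorov
  `V_{s+t} = V_t ∘ₖ V_s`** (from `lintegral_U_add` and the reindexing of the double series by
  antidiagonals, `ennreal_tsum_sum_range_antidiagonal`);
* `lintegral_expMeasure_lintegral_U` — **the Laplace transform of the jump expansion is a Neumann
  series**: for `a > 0`, `R = R_{a+r} = K ∘ₖ (const Exp_{a+r} ×ₖ id)` (the unperturbed chain at an
  independent exponential time of rate `a + r`) and `W_n = R (Q R)^n`,
  `∫ Exp_a(dt) ∫ f dU_n(t, x) = (a/(a+r)) (r/(a+r))^n ∫ f dW_n(x)`: the exponential weight factorises over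
  the time since the last jump, turning the time convolution of the recursion into a kernel composition.
  Summed over `n` this identifies the resolvent of `V` at rate `a` with the Neumann-series kernel
  `∑_n p_n W_n` whose resolvent identity (generator `L + r(Q - 1)`) is `…JumpPerturbationResolvent.lean`.

No definitions. Registered sub-goal: `helper_jumpLaplaceNeumann`. References: Ethier–Kurtz 1986, Ch. 1 §7,
Ch. 4 §10; Phillips 1953; folklore.
-/

noncomputable section

namespace Summit.AtomisticToContinuum.FouriersLaw.Theorems.VanishingNoiseBound.JumpPerturbation

open MeasureTheory ProbabilityTheory Filter Topology Set Function
open scoped NNReal ENNReal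
open Literature.MathematicalPhysics.KineticTheory.HeatConduction

variable {X : Type*} [MeasurableSpace X]

/-! ### The perturbed semigroup `P^Q_t = ∑_n U_n(t)` -/

/-- Reindexing a double series over `ℕ × ℕ` by antidiagonals, in `ℝ≥0∞` (no summability needed):
`∑_n ∑_{k ≤ n} a k (n - k) = ∑_k ∑_m a k m`. [folklore] -/
theorem ennreal_tsum_sum_range_antidiagonal (a : ℕ → ℕ → ℝ≥0∞) :
    ∑' n, ∑ k ∈ Finset.range (n + 1), a k (n - k) = ∑' k, ∑' m, a k m := by
  -- adapted from Mathlib's `Summable.tsum_mul_tsum_eq_tsum_sum_antidiagonal`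
  simp_rw [← Finset.Nat.sum_antidiagonal_eq_sum_range_succ a]
  rw [← ENNReal.tsum_prod (f := a),
    ← Finset.HasAntidiagonal.sigmaAntidiagonalEquivProd.tsum_eq (fun p : ℕ × ℕ => a p.1 p.2),
    ENNReal.tsum_sigma']
  refine tsum_congr fun n => ?_
  rw [← Finset.tsum_subtype]
  rfl

section Semigroup

variable (K : Kernel (ℝ × X) X) (Q : Kernel X X) {r : ℝ}
  (hr : 0 < r)
  (hKadd : ∀ s t : ℝ, 0 ≤ s → 0 ≤ t → ∀ (x : X) (f : X → ℝ≥0∞), Measurable f →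
    ∫⁻ z, f z ∂(K (s + t, x)) = ∫⁻ y, ∫⁻ z, f z ∂(K (t, y)) ∂(K (s, x)))
  (U : ℕ → Kernel (ℝ × X) X)
  (hU0 : ∀ p : ℝ × X, 0 ≤ p.1 → U 0 p = ENNReal.ofReal (Real.exp (-(r * p.1))) • K p)
  (hUsucc : ∀ (n : ℕ) (p : ℝ × X) (f : X → ℝ≥0∞), Measurable f →
    ∫⁻ z, f z ∂(U (n + 1) p) =
      ∫⁻ s, (Iio p.1).indicator (fun s =>
        ∫⁻ y, ∫⁻ y', ∫⁻ z, f z ∂(K (s, y')) ∂(Q y) ∂(U n (p.1 - s, p.2))) s ∂(expMeasure r))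
  (V : ℝ≥0 → Kernel X X) (hV : ∀ (t : ℝ≥0) (x : X), V t x = Measure.sum fun n => U n ((t : ℝ), x))

include hV in
/-- Integration against the perturbed kernel: `∫ f dP^Q_t(x, ·) = ∑_n ∫ f dU_n(t, x)`. [folklore] -/
theorem lintegral_V (t : ℝ≥0) (x : X) (f : X → ℝ≥0∞) :
    ∫⁻ z, f z ∂(V t x) = ∑' n, ∫⁻ z, f z ∂(U n ((t : ℝ), x)) := by
  rw [hV t x, lintegral_sum_measure]

include hr hU0 hUsucc hV in
/-- **The perturbed kernels are Markov**: `P^Q_t(x, X) = ∑_n U_n(t, x)(X) = 1`. [folklore] -/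
theorem isMarkovKernel_V [IsMarkovKernel K] [IsMarkovKernel Q] (t : ℝ≥0) : IsMarkovKernel (V t) := by
  refine ⟨fun x => ⟨?_⟩⟩
  rw [hV t x, Measure.sum_apply _ MeasurableSet.univ]
  exact (hasSum_measure_univ_U K Q hr U hU0 hUsucc t.coe_nonneg x).tsum_eq

include hU0 hV in
/-- **Domination by the jump-free evolution**: `P^Q_t(x, ·) ≥ e^{-rt} P_t(x, ·)` (the event of no
jump in `[0, t]`) — the source of minorisation / irreducibility for the perturbed semigroup.
[folklore] -/
theorem smul_kernel_le_V (t : ℝ≥0) (x : X) :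
    ENNReal.ofReal (Real.exp (-(r * t))) • K ((t : ℝ), x) ≤ V t x := by
  rw [hV t x, ← hU0 ((t : ℝ), x) t.coe_nonneg]
  exact Measure.le_sum _ 0

include hr hKadd hU0 hUsucc hV in
/-- **Chapman–Kolmogorov for the perturbed semigroup**: `P^Q_{s+t} = P^Q_t ∘ₖ P^Q_s` (first `s`, then
`t`), from the decomposition by the number of jumps (`lintegral_U_add`) and the reindexing of the
double series by antidiagonals. [Ethier–Kurtz 1986, Ch. 4 §10; folklore] -/
theorem V_add [IsSFiniteKernel Q] [∀ n, IsFiniteKernel (U n)] (s t : ℝ≥0) : V (s + t) = V t ∘ₖ V s := by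
  refine Kernel.ext fun x => Measure.ext_of_lintegral _ fun f hf => ?_
  rw [lintegral_V U V hV, Kernel.lintegral_comp _ _ _ hf]
  have h1 : ∀ n, ∫⁻ z, f z ∂(U n (((s + t : ℝ≥0) : ℝ), x)) =
      ∑ k ∈ Finset.range (n + 1), ∫⁻ y, (∫⁻ z, f z ∂(U (n - k) ((t : ℝ), y))) ∂(U k ((s : ℝ), x)) := by
    intro n
    rw [NNReal.coe_add]
    exact lintegral_U_add K Q hr hKadd U hU0 hUsucc n s.coe_nonneg t.coe_nonneg x hf
  simp_rw [h1]
  rw [ennreal_tsum_sum_range_antidiagonal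
    (fun k m => ∫⁻ y, (∫⁻ z, f z ∂(U m ((t : ℝ), y))) ∂(U k ((s : ℝ), x)))]
  have h2 : ∀ y, ∫⁻ z, f z ∂(V t y) = ∑' m, ∫⁻ z, f z ∂(U m ((t : ℝ), y)) :=
    fun y => lintegral_V U V hV t y f
  simp_rw [h2]
  rw [hV s x, lintegral_sum_measure]
  refine tsum_congr fun k => ?_
  rw [lintegral_tsum fun m => (measurable_lintegral_slice (U m) (t : ℝ) hf).aemeasurable]

end Semigroup

/-! ### The Laplace transform of the jump expansion: a Neumann series of resolvent kernels -/

section Laplace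

variable (K : Kernel (ℝ × X) X) (Q : Kernel X X) {r : ℝ}
  (hr : 0 < r)
  (U : ℕ → Kernel (ℝ × X) X)
  (hU0 : ∀ p : ℝ × X, 0 ≤ p.1 → U 0 p = ENNReal.ofReal (Real.exp (-(r * p.1))) • K p)
  (hUsucc : ∀ (n : ℕ) (p : ℝ × X) (f : X → ℝ≥0∞), Measurable f →
    ∫⁻ z, f z ∂(U (n + 1) p) =
      ∫⁻ s, (Iio p.1).indicator (fun s =>
        ∫⁻ y, ∫⁻ y', ∫⁻ z, f z ∂(K (s, y')) ∂(Q y) ∂(U n (p.1 - s, p.2))) s ∂(expMeasure r))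
  {a : ℝ} (ha : 0 < a)
  (R : Kernel X X) (hR : R = K ∘ₖ (Kernel.const X (expMeasure (a + r)) ×ₖ Kernel.id))
  (W : ℕ → Kernel X X) (hW0 : W 0 = R) (hWsucc : ∀ n, W (n + 1) = R ∘ₖ (Q ∘ₖ W n))

/-- Measurability of `t ↦ ∫ f dκ(t, x)` for a kernel `κ` on `ℝ × X` at a frozen state. [folklore] -/
theorem measurable_lintegral_time (κ : Kernel (ℝ × X) X) (x : X) {f : X → ℝ≥0∞} (hf : Measurable f) :
    Measurable fun t : ℝ => ∫⁻ z, f z ∂(κ (t, x)) := by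
  have : Measurable fun t : ℝ => ∫⁻ z, f z ∂((κ.comap (fun t : ℝ => (t, x)) measurable_prodMk_right) t) :=
    hf.lintegral_kernel
  simpa only [Kernel.comap_apply] using this

/-- The exponential density splits over a shifted time: `a e^{-a(σ+s)} = (a e^{-aσ}) · e^{-as}`, in
`ℝ≥0∞`. [folklore] -/
theorem ofReal_expDensity_add {c : ℝ} (hc : 0 ≤ c) (σ s : ℝ) :
    ENNReal.ofReal (c * Real.exp (-(c * (σ + s)))) =
      ENNReal.ofReal (c * Real.exp (-(c * σ))) * ENNReal.ofReal (Real.exp (-(c * s))) := by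
  rw [← ENNReal.ofReal_mul (by positivity), show -(c * (σ + s)) = -(c * σ) + -(c * s) by ring,
    Real.exp_add, mul_assoc]

include hr ha in
/-- `r e^{-rs} e^{-as} = (r/(a+r)) · (a+r) e^{-(a+r)s}` in `ℝ≥0∞`. [folklore] -/
theorem ofReal_expDensity_mul_exp (s : ℝ) :
    ENNReal.ofReal (r * Real.exp (-(r * s))) * ENNReal.ofReal (Real.exp (-(a * s))) =
      ENNReal.ofReal (r / (a + r)) * ENNReal.ofReal ((a + r) * Real.exp (-((a + r) * s))) := by
  have hb : 0 < a + r := by linarith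
  rw [← ENNReal.ofReal_mul (by positivity), ← ENNReal.ofReal_mul (by positivity)]
  congr 1
  rw [show -((a + r) * s) = -(r * s) + -(a * s) by ring, Real.exp_add]
  field_simp

include hr ha in
/-- `a e^{-at} e^{-rt} = (a/(a+r)) · (a+r) e^{-(a+r)t}` in `ℝ≥0∞`. [folklore] -/
theorem ofReal_expDensity_mul_exp' (t : ℝ) :
    ENNReal.ofReal (a * Real.exp (-(a * t))) * ENNReal.ofReal (Real.exp (-(r * t))) =
      ENNReal.ofReal (a / (a + r)) * ENNReal.ofReal ((a + r) * Real.exp (-((a + r) * t))) := by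
  have hb : 0 < a + r := by linarith
  rw [← ENNReal.ofReal_mul (by positivity), ← ENNReal.ofReal_mul (by positivity)]
  congr 1
  rw [show -((a + r) * t) = -(a * t) + -(r * t) by ring, Real.exp_add]
  field_simp

omit [MeasurableSpace X] in
include hr ha in
/-- The geometric weights `p_n = (a/(a+r)) (r/(a+r))^n` telescope: `p_n · (r/(a+r)) = p_{n+1}`.
[folklore] -/
theorem laplaceWeight_succ (n : ℕ) :
    ENNReal.ofReal (a / (a + r) * (r / (a + r)) ^ n) * ENNReal.ofReal (r / (a + r)) =
      ENNReal.ofReal (a / (a + r) * (r / (a + r)) ^ (n + 1)) := by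
  have hb : 0 < a + r := by linarith
  rw [← ENNReal.ofReal_mul (by positivity), pow_succ, mul_assoc]

include hr hU0 hUsucc ha hR hW0 hWsucc in
/-- **The Laplace transform of the jump expansion is a Neumann series.** For `a > 0`, with
`R = R_{a+r}` the flip-free chain observed at an independent exponential time of rate `a + r` and
`W_n = R (Q R)^n` (`W_0 = R`, `W_{n+1} = R ∘ₖ Q ∘ₖ W_n`):
`∫ Exp_a(dt) ∫ f dU_n(t, x) = (a/(a+r)) (r/(a+r))^n ∫ f dW_n(x)` — averaging the `n`-jump term over an
exponential time of rate `a` gives the geometric weight times `n` alternations of "run until an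
exponential time of rate `a + r`" and "jump". Induction on `n`: the exponential weight factorises over
the time since the last jump, which turns the last-jump recursion (a time convolution) into a kernel
composition. [Ethier–Kurtz 1986, Ch. 1 §7 and Ch. 4 §10; folklore] -/
theorem lintegral_expMeasure_lintegral_U [IsSFiniteKernel K] [IsMarkovKernel Q] [∀ n, IsFiniteKernel (U n)]
    [∀ n, IsSFiniteKernel (W n)] (n : ℕ) (x : X) {f : X → ℝ≥0∞} (hf : Measurable f) :
    ∫⁻ t, (∫⁻ z, f z ∂(U n (t, x))) ∂(expMeasure a) =
      ENNReal.ofReal (a / (a + r) * (r / (a + r)) ^ n) * ∫⁻ z, f z ∂(W n x) := by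
  have hb : 0 < a + r := by linarith
  haveI := isProbabilityMeasure_expMeasure ha
  haveI := isProbabilityMeasure_expMeasure hb
  haveI := isProbabilityMeasure_expMeasure hr
  induction n generalizing x f with
  | zero =>
    rw [pow_zero, mul_one, lintegral_expMeasure a (measurable_lintegral_time (U 0) x hf),
      ← lintegral_indicator measurableSet_Ioi]
    have hpt : ∀ t, (Ioi (0:ℝ)).indicator (fun t => ENNReal.ofReal (a * Real.exp (-(a * t))) *
        ∫⁻ z, f z ∂(U 0 (t, x))) t = (Ioi (0:ℝ)).indicator (fun t => ENNReal.ofReal (a / (a + r)) *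
        (ENNReal.ofReal ((a + r) * Real.exp (-((a + r) * t))) * ∫⁻ z, f z ∂(K (t, x)))) t := by
      intro t
      by_cases ht : 0 < t
      · rw [indicator_of_mem (mem_Ioi.2 ht), indicator_of_mem (mem_Ioi.2 ht), hU0 (t, x) ht.le,
          lintegral_smul_measure, smul_eq_mul, ← mul_assoc, ofReal_expDensity_mul_exp' hr ha t, mul_assoc]
      · rw [indicator_of_notMem (fun h => ht (mem_Ioi.1 h)), indicator_of_notMem (fun h => ht (mem_Ioi.1 h))]
    simp_rw [hpt]
    rw [lintegral_indicator measurableSet_Ioi, lintegral_const_mul' _ _ ENNReal.ofReal_ne_top,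
      ← lintegral_expMeasure (a + r) (measurable_lintegral_time K x hf), hW0, hR,
      lintegral_comp_const_prod_id K _ x hf]
  | succ n ih =>
    -- the one-jump observable
    set G : ℝ × X → ℝ≥0∞ := fun q => ∫⁻ y', ∫⁻ z, f z ∂(K (q.1, y')) ∂(Q q.2) with hG
    have hGm : Measurable G := measurable_jumpObs K Q hf
    -- Φ(s', σ) := ∫ G(s', y) dU_n(σ, x)(y), jointly measurable in `(t, s')` through `σ = t - s'`
    have hΦm : Measurable fun q : ℝ × ℝ => ∫⁻ y, G (q.2, y) ∂(U n (q.1 - q.2, x)) := by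
      have h : Measurable fun q : ℝ × ℝ => ∫⁻ y, (fun u : (ℝ × ℝ) × X => G (u.1.2, u.2)) (q, y)
          ∂(((U n).comap (fun q : ℝ × ℝ => (q.1 - q.2, x)) (by fun_prop)) q) :=
        Measurable.lintegral_kernel_prod_right' (hGm.comp ((measurable_snd.comp measurable_fst).prodMk
          measurable_snd))
      simpa only [Kernel.comap_apply] using h
    -- Step 1: unfold one step of the recursion and write both time laws as Lebesgue integrals
    have h1 : ∀ t, ∫⁻ z, f z ∂(U (n + 1) (t, x)) = ∫⁻ s, (Iio t ∩ Ioi 0).indicator (fun s =>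
        ENNReal.ofReal (r * Real.exp (-(r * s))) * ∫⁻ y, G (s, y) ∂(U n (t - s, x))) s := by
      intro t
      rw [hUsucc n (t, x) f hf]
      exact lintegral_expMeasure_indicator' r measurableSet_Iio
        (hΦm.comp (measurable_const.prodMk measurable_id))
    simp_rw [h1]
    -- the integrand on `ℝ × ℝ` (time of the exponential clock `t`, time since the last jump `s`)
    set H : ℝ → ℝ → ℝ≥0∞ := fun t s => (Iio t ∩ Ioi 0).indicator (fun s =>
        ENNReal.ofReal (r * Real.exp (-(r * s))) * ∫⁻ y, G (s, y) ∂(U n (t - s, x))) s with hH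
    have hHm : Measurable (uncurry H) := by
      have hset : MeasurableSet {q : ℝ × ℝ | q.2 < q.1 ∧ 0 < q.2} :=
        (measurableSet_lt measurable_snd measurable_fst).inter (measurableSet_lt measurable_const measurable_snd)
      have : uncurry H = {q : ℝ × ℝ | q.2 < q.1 ∧ 0 < q.2}.indicator (fun q =>
          ENNReal.ofReal (r * Real.exp (-(r * q.2))) * ∫⁻ y, G (q.2, y) ∂(U n (q.1 - q.2, x))) := by
        funext q
        simp only [hH, uncurry, indicator, mem_inter_iff, mem_Iio, mem_Ioi, mem_setOf_eq]
      rw [this]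
      refine Measurable.indicator ?_ hset
      exact ((ENNReal.measurable_ofReal.comp (by fun_prop)).mul hΦm)
    change ∫⁻ t, ∫⁻ s, H t s ∂volume ∂(expMeasure a) = _
    -- Step 2: Tonelli, then for a frozen `s > 0` shift the clock time `t = σ + s`
    rw [lintegral_lintegral_swap hHm.aemeasurable]
    have h2 : ∀ s, ∫⁻ t, H t s ∂(expMeasure a) = (Ioi (0:ℝ)).indicator (fun s =>
        ENNReal.ofReal (r * Real.exp (-(r * s))) * ENNReal.ofReal (Real.exp (-(a * s))) *
          (ENNReal.ofReal (a / (a + r) * (r / (a + r)) ^ n) * ∫⁻ y, G (s, y) ∂(W n x))) s := by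
      intro s
      by_cases hs : 0 < s
      · rw [indicator_of_mem (mem_Ioi.2 hs)]
        have hHs : ∀ t, H t s = (Ioi s).indicator (fun t =>
            ENNReal.ofReal (r * Real.exp (-(r * s))) * ∫⁻ y, G (s, y) ∂(U n (t - s, x))) t := by
          intro t
          simp only [hH, indicator, mem_inter_iff, mem_Iio, mem_Ioi]
          by_cases hts : s < t
          · simp [hts, hs]
          · simp [hts]
        simp_rw [hHs]
        have hm1 : Measurable fun t => ∫⁻ y, G (s, y) ∂(U n (t - s, x)) :=
          hΦm.comp (measurable_id.prodMk measurable_const)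
        rw [lintegral_expMeasure a ((hm1.const_mul _).indicator measurableSet_Ioi),
          ← lintegral_indicator measurableSet_Ioi]
        -- shift `t = σ + s`
        rw [← lintegral_add_right_eq_self (μ := (volume : Measure ℝ)) _ s]
        have hpt : ∀ σ, (Ioi (0:ℝ)).indicator (fun t => ENNReal.ofReal (a * Real.exp (-(a * t))) *
            (Ioi s).indicator (fun t => ENNReal.ofReal (r * Real.exp (-(r * s))) *
              ∫⁻ y, G (s, y) ∂(U n (t - s, x))) t) (σ + s) =
            (Ioi (0:ℝ)).indicator (fun σ => ENNReal.ofReal (r * Real.exp (-(r * s))) *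
              ENNReal.ofReal (Real.exp (-(a * s))) * (ENNReal.ofReal (a * Real.exp (-(a * σ))) *
                ∫⁻ y, G (s, y) ∂(U n (σ, x)))) σ := by
          intro σ
          by_cases hσ : 0 < σ
          · have h01 : σ + s ∈ Ioi (0:ℝ) := by change (0:ℝ) < σ + s; linarith
            have h02 : σ + s ∈ Ioi s := by change s < σ + s; linarith
            rw [indicator_of_mem h01, indicator_of_mem h02, indicator_of_mem (mem_Ioi.2 hσ),
              add_sub_cancel_right, ofReal_expDensity_add ha.le σ s]
            ring
          · have h02 : σ + s ∉ Ioi s := fun h => hσ (by change s < σ + s at h; linarith)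
            rw [indicator_of_notMem (fun h => hσ (mem_Ioi.1 h))]
            by_cases h01 : σ + s ∈ Ioi (0:ℝ)
            · rw [indicator_of_mem h01, indicator_of_notMem h02, mul_zero]
            · rw [indicator_of_notMem h01]
        simp_rw [hpt]
        have hm2 : Measurable fun σ => ENNReal.ofReal (a * Real.exp (-(a * σ))) *
            ∫⁻ y, G (s, y) ∂(U n (σ, x)) :=
          (ENNReal.measurable_ofReal.comp (by fun_prop)).mul
            (measurable_lintegral_time (U n) x (hGm.comp (measurable_const.prodMk measurable_id)))
        have hGs : Measurable (fun y => G (s, y)) := hGm.comp (measurable_const.prodMk measurable_id)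
        rw [lintegral_indicator measurableSet_Ioi, lintegral_const_mul' _ _ (by
          exact ENNReal.mul_ne_top ENNReal.ofReal_ne_top ENNReal.ofReal_ne_top),
          ← lintegral_expMeasure a (measurable_lintegral_time (U n) x (f := fun y => G (s, y)) hGs)]
        -- the induction hypothesis, for the observable `G(s, ·)`
        rw [ih x (f := fun y => G (s, y)) hGs]
      · rw [indicator_of_notMem (fun h => hs (mem_Ioi.1 h))]
        have hH0 : ∀ t, H t s = 0 := fun t => by
          simp only [hH, indicator, mem_inter_iff, mem_Iio, mem_Ioi]
          simp [hs]
        simp_rw [hH0, lintegral_zero]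
    simp_rw [h2]
    -- Step 3: collect the constants: `r e^{-rs} e^{-as} = (r/(a+r)) (a+r) e^{-(a+r)s}`
    have h3 : ∀ s, (Ioi (0:ℝ)).indicator (fun s =>
        ENNReal.ofReal (r * Real.exp (-(r * s))) * ENNReal.ofReal (Real.exp (-(a * s))) *
          (ENNReal.ofReal (a / (a + r) * (r / (a + r)) ^ n) * ∫⁻ y, G (s, y) ∂(W n x))) s =
        (Ioi (0:ℝ)).indicator (fun s => (ENNReal.ofReal (a / (a + r) * (r / (a + r)) ^ n) *
          ENNReal.ofReal (r / (a + r))) * (ENNReal.ofReal ((a + r) * Real.exp (-((a + r) * s))) *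
            ∫⁻ y, G (s, y) ∂(W n x))) s := by
      intro s
      by_cases hs : 0 < s
      · rw [indicator_of_mem (mem_Ioi.2 hs), indicator_of_mem (mem_Ioi.2 hs),
          ofReal_expDensity_mul_exp hr ha s]
        ring
      · rw [indicator_of_notMem (fun h => hs (mem_Ioi.1 h)), indicator_of_notMem (fun h => hs (mem_Ioi.1 h))]
    simp_rw [h3]
    have hm3 : Measurable fun s => ∫⁻ y, G (s, y) ∂(W n x) := hGm.lintegral_prod_right'
    rw [lintegral_indicator measurableSet_Ioi, lintegral_const_mul' _ _ (by
        exact ENNReal.mul_ne_top ENNReal.ofReal_ne_top ENNReal.ofReal_ne_top),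
      ← lintegral_expMeasure (a + r) hm3, laplaceWeight_succ hr ha n]
    congr 1
    -- Step 4: Tonelli twice and the definition of `R`: `∫ Exp_{a+r}(ds) ∫ W_n(x,dy) G(s, y) = ∫ f dW_{n+1}(x)`
    rw [lintegral_lintegral_swap hGm.aemeasurable]
    rw [hWsucc n, Kernel.lintegral_comp _ _ _ hf, Kernel.lintegral_comp _ _ _ hf.lintegral_kernel]
    refine lintegral_congr fun y => ?_
    have hgm : Measurable fun q : ℝ × X => ∫⁻ z, f z ∂(K (q.1, q.2)) := hf.lintegral_kernel
    change ∫⁻ s, ∫⁻ y', (fun q : ℝ × X => ∫⁻ z, f z ∂(K (q.1, q.2))) (s, y') ∂(Q y) ∂(expMeasure (a + r)) = _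
    rw [lintegral_lintegral_swap (hgm.aemeasurable)]
    refine lintegral_congr fun y' => ?_
    rw [hR, lintegral_comp_const_prod_id K _ y' hf]

end Laplace

/-- **Registered sub-goal `helper_jumpLaplaceNeumann`** of stmt-AtomisticToContinuum-11976 (brick for stub S3
`stub_noisyPositiveConductance`): `lintegral_expMeasure_lintegral_U` (the Laplace transform of the jump
expansion is the Neumann series of resolvent kernels) on the phase space of the `N`-particle chain, fully
quantified and notation-free. [folklore] -/
theorem helper_jumpLaplaceNeumann : ∀ (N : ℕ) (K : ProbabilityTheory.Kernel (ℝ × Literature.MathematicalPhysics.KineticTheory.HeatConduction.PhaseSpace N) (Literature.MathematicalPhysics.KineticTheory.HeatConduction.PhaseSpace N)) [ProbabilityTheory.IsSFiniteKernel K] (Q : ProbabilityTheory.Kernel (Literature.MathematicalPhysics.KineticTheory.HeatConduction.PhaseSpace N) (Literature.MathematicalPhysics.KineticTheory.HeatConduction.PhaseSpace N)) [ProbabilityTheory.IsMarkovKernel Q] (r : ℝ), 0 < r → ∀ (U : ℕ → ProbabilityTheory.Kernel (ℝ × Literature.MathematicalPhysics.KineticTheory.HeatConduction.PhaseSpace N)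 (Literature.MathematicalPhysics.KineticTheory.HeatConduction.PhaseSpace N)) [∀ n, ProbabilityTheory.IsFiniteKernel (U n)], (∀ p : ℝ × Literature.MathematicalPhysics.KineticTheory.HeatConduction.PhaseSpace N, 0 ≤ p.1 → U 0 p = ENNReal.ofReal (Real.exp (-(r * p.1))) • K p) → (∀ (n : ℕ) (p : ℝ × Literature.MathematicalPhysics.KineticTheory.HeatConduction.PhaseSpace N) (f : Literature.MathematicalPhysics.KineticTheory.HeatConduction.PhaseSpace N → ENNReal), Measurable f → MeasureTheory.lintegral (U (n + 1) p) (fun z => f z) = MeasureTheory.lintegral (ProbabilityTheory.expMeasure r) (fun s => (Set.Iio p.1).indicator (fun s => MeasureTheory.lintegral (U n (p.1 - s, p.2)) (fun y => MeasureTheory.lintegral (Q y) (fun y' => MeasureTheory.lintegral (K (s, y')) (fun z => f z)))) s)) → ∀ (a : ℝ), 0 < a → ∀ (R : ProbabilityTheory.Kernel (Literature.MathematicalPhysics.KineticTheory.HeatConduction.PhaseSpace N) (Literature.MathematicalPhysics.KineticTheory.HeatConduction.PhaseSpace N)), R = ProbabilityTheory.Kernel.comp K (ProbabilityTheory.Kernel.prod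 (ProbabilityTheory.Kernel.const (Literature.MathematicalPhysics.KineticTheory.HeatConduction.PhaseSpace N) (ProbabilityTheory.expMeasure (a + r))) ProbabilityTheory.Kernel.id) → ∀ (W : ℕ → ProbabilityTheory.Kernel (Literature.MathematicalPhysics.KineticTheory.HeatConduction.PhaseSpace N) (Literature.MathematicalPhysics.KineticTheory.HeatConduction.PhaseSpace N)) [∀ n, ProbabilityTheory.IsSFiniteKernel (W n)], W 0 = R → (∀ n, W (n + 1) = ProbabilityTheory.Kernel.comp R (ProbabilityTheory.Kernel.comp Q (W n))) → ∀ (n : ℕ) (x : Literature.MathematicalPhysics.KineticTheory.HeatConduction.PhaseSpace N) (f : Literature.MathematicalPhysics.KineticTheory.HeatConduction.PhaseSpace N → ENNReal), Measurable f → MeasureTheory.lintegral (ProbabilityTheory.expMeasure a) (fun t => MeasureTheory.lintegral (U n (t, x)) (fun z => f z)) = ENNReal.ofReal (a / (a + r) * (r / (a + r)) ^ n) * MeasureTheory.lintegral (W n x) (fun z => f z) :=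
  fun _ K _ Q _ _ hr U _ hU0 hUsucc _ ha R hR W _ hW0 hWsucc n x _ hf =>
    lintegral_expMeasure_lintegral_U K Q hr U hU0 hUsucc ha R hR W hW0 hWsucc n x hf

end Summit.AtomisticToContinuum.FouriersLaw.Theorems.VanishingNoiseBound.JumpPerturbation

end
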